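import Summits.KontsevichZagierPeriods.KontsevichZagierPeriods.Theses.UnfoldedStokes
import Summits.KontsevichZagierPeriods.KontsevichZagierPeriods.Theorems.CubeKernelStep.Negative.Calibration
import Summits.KontsevichZagierPeriods.KontsevichZagierPeriods.Theorems.CubeKernelStep.Negative.FirstLayerRule2
import Summits.KontsevichZagierPeriods.KontsevichZagierPeriods.Theorems.CubeKernelStep.Negative.SecondWindow
import Summits.KontsevichZagierPeriods.KontsevichZagierPeriods.Theorems.CubeKernelStep.Negative.StepRule2
import Summits.KontsevichZagierPeriods.KontsevichZagierPeriods.Theorems.CubeKernelStep.Negative.NotFibred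
import Summits.KontsevichZagierPeriods.KontsevichZagierPeriods.Theorems.CubeKernelStep.Negative.IdealSlices
import Literature.NumberTheory.Transcendental.KZFibredRelations

/-!
# Disproof of `CubeKernelStep` (stmt-KontsevichZagierPeriods-17854) — findings

Standing disprover's work file (cdisprove, cycle 1; refuter-cdisprove-stmt-KontsevichZagierPeriods-17854-0).
Prose only in docstrings; every claim is kernel-checked and LANDED under
`Theorems/CubeKernelStep/Negative/` unless marked OPEN HANDLE (§E, stated as `def … : Prop`, no sorry).

THE CRUX. `CubeKernelStep : ∀ d ≥ 1, (∀ M ≤ d, Kc M) → Kc (d+1)`, where `Kc M` = "every representation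
on the closed cube `[0,1]^M` with integrand continuous on the closed cube and value `0` is a relation".

**VERDICT: NO KILL, and none is possible short of disproving the period conjecture.**
`not_cubeKernelStep_iff : ¬ CubeKernelStep ↔ (Kc 1 ∧ ∃ M, ¬ Kc M)` (§0): a refutation must PROVE the
open interval layer (Huber–Wüstholz strength inside the calculus) AND refute a higher layer, i.e. the
kernel conjecture, i.e. the summit (`not_summit_of_not_cubeKernelStep`). Conversely every sub-calculus
in which layer 1 fails is a MODEL of the crux (vacuity mechanism, §B) — so small-model / invariant
refutation is hopeless by design. What the disprover CAN do, and did, is the load-bearing analysis of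
the MOVES: which rules any proof of the step must use, unconditionally (§A, §C).

## Findings (index; file ↦ landed proposal)

* §0 CALIBRATION — `Negative/Calibration.lean` (p146120 ACCEPTED): `KcIn R M`, `StepIn R`
  (`CubeKernelStep ↔ StepIn relations`, `Iff.rfl`); `kcIn_zero` (layer 0 holds in any `R ⊇ (1b)`);
  `stepIn_iff : StepIn R ↔ (KcIn R 1 → ∀ M, KcIn R M)` given layer 0 — the induction dressing adds
  nothing; `cubeKernelStep_iff`, `not_cubeKernelStep_iff`, `not_kernelConjecture_of_not_cubeKernelStep`,
  `not_summit_of_not_cubeKernelStep`, `kcIn_one_of_not_cubeKernelStep`.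
* §A LOAD-BEARING HYPOTHESES —
  - `1 ≤ d`: `stepFromZeroIn_iff` (Calibration): deleting it gives "ALL layers" (summit-implied, open);
    and in the rule-(2)-free calculus the deleted form is FALSE (`stepFromZero_false_without_changeOfVariables`,
    FirstLayerRule2): the `0 → 1` step fails there. So `1 ≤ d` is exactly the conditionality, and the
    interval layer it hides is a CHANGE-OF-VARIABLES phenomenon (functoriality / correspondences,
    Huber–Wüstholz), never additivity + Newton–Leibniz.
  - `t.value = 0`: load-bearing modulo layer 1 (`stepWithoutValue_false_of_kcIn_one`, Calibration;
    unconditional form impossible since the implication's hypothesis is open).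
  - `ContinuousOn` / closed-cube shape: normal-form conveniences (by ContinuousCubification 17853 +
    `exists_liftCube` they cost nothing globally) but they FIX THE DIMENSION COUNT layer by layer; no
    `_false_without_` form exists (dropping them keeps the statement summit-implied).
  - the induction hypothesis `∀ M ≤ d, Kc M`: consumed at `M = 1` only, logically (`stepIn_iff`); where
    a PROOF uses `Kc d` is the lines' business (solid_step: volume transfer; relative-injectivity: the
    ideal `I_d`).
* §B TIGHTNESS / MODELS — `FirstLayerRule2.lean` (p146121 ACCEPTED): the sub-calculus
  `rulesOneThree = closure ((1a) ∪ (1b) ∪ (3))` satisfies the statement of the crux VACUOUSLY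
  (`step_without_changeOfVariables`) while EVERY positive layer fails in it
  (`layer_succ_false_without_changeOfVariables`, witness `kernelRep = [[0,1], 2t/(2−t²) − 1/(2−t)]` and
  its slab lifts; invariant: first-coordinate window values are `ℚ`-semialgebraic up to a constant along
  (1),(3)-chains — tree `PlanarAreas.Negative.winSemialgebraic_of_mem` — versus the clamped
  `log (2−e) − log (2−e²)` and the barrier `algebraicPrimitivesObstructionNarrow_holds`).
* §C NATURAL STRENGTHENINGS REFUTED —
  - ★ `cubeKernelStep_false_without_changeOfVariables` (`StepRule2.lean`): the crux with `relations`
    replaced by `rulesOneThreeLow = closure ((1a) ∪ (1b) ∪ (3) ∪ {[r] : dim r ≤ 1})` is FALSE at `d = 1`.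
    Everything of dimension `≤ 1` is GRANTED (so the interval layer holds trivially), yet the continuous
    square kernel element `sqRep = [[0,1]², 1/(1+x) − s/(2−sx) − s/(1+sx)]` (value `0`) is not generated.
    ANY PROOF OF THE STEP `1 → 2` USES RULE (2) IN DIMENSION ≥ 2. Invariant (`SecondWindow.lean`,
    p146163 ACCEPTED): second-layer window values `Λ²ₑ` (window `{x₀ < e}` in dims ≥ 2 only) have, along
    `rulesOneThreeLow`, a `ℚ`-semialgebraic derivative off a finite set (`hasSADeriv_of_mem`; the NL
    `2 → 1` defect is a running integral of a one-variable semialgebraic function — monotonicity theorem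
    + FTC); for `sqRep` that derivative is the PERIOD FUNCTION `V(s) = log ((2−s)/(1+s))`,
    `((s−2)(s+1))V′ = 3`, not algebraic over `ℝ(s)` even off a finite set (descent
    `NoSemialgPrimKernel.eq_zero_of_evalEval_eq_zero`).
  - ★★ `cubeKernelStep_false_fibred` (`NotFibred.lean`): sharper — the crux with `relations` replaced by
    `KZ.fibredRelations ⊔ closure lowDim` (ALL additivity, ALL parameter-preserving substitutions
    `Φ x 0 = x 0` in every dimension, ALL Newton–Leibniz moves over positive-dimensional bases — Ayoub's
    relative rules — plus every relation of dimension `≤ 1`) is FALSE at `d = 1` on the same `sqRep`.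
    Invariant: slices of fibred relations vanish a.e. (tree `KZ.sliceEval_ae_eq_zero`), slices of
    low-dim combinations are semialgebraic, the slice of `sqRep` is `V`. SO: ANY PROOF OF THE STEP
    `1 → 2` CONTAINS A MOVE THAT MOVES THE PARAMETER COORDINATE (integration along the parameter after
    a transposition, or a base change). `rulesOneThreeLow ≤ fibredRelations ⊔ closure lowDim`
    (`rulesOneThreeLow_le_fibred`), so ★ is a corollary of ★★.
  - ★★★ `cubeKernelStep_false_fibred_mod_ideal` (`IdealSlices.lean`): the same even MODULO THE
    LOWER-KERNEL IDEAL `I₁ = ⟨x * [a] : a a continuous cube kernel element of dim ≤ 1⟩` (the cards'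
    type-(b) relators, `lowerKernelGens 1` verbatim): `¬ StepIn (fibredRelations ⊔ closure lowDim ⊔
    closure (lowerKernelGens 1))`. Slices of products `[r]*[a]` are `0`, semialgebraic, or a.e. `0`
    (rational slab values `value(r|slab)·value(a) = 0`).
  - Reading (`hasSADeriv_marginal_of_mem`): additivity + Newton–Leibniz ALONG ONE COORDINATE DIRECTION
    (+ anything of dim ≤ 1) reach only square elements whose first marginal `V(s) = ∫ h(s,x)dx` is
    semialgebraic off finitely many points. Derivatives along a second direction enter the calculus only
    through a coordinate PERMUTATION = rule (2) (cf. S3 `stub_fibrewiseStokesCalibration` of the parent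
    line, which permutes `i` last: that permutation is ESSENTIAL, not cosmetic).
  - "one fibre primitive suffices" (naive Ayoub Rem. 1.2 induction): dead at layer 1 by the tree barrier
    `kernelElt_not_stokes_one_variable` (not re-proved here).
  - `StepWithoutValueIn relations` dead modulo layer 1 (§A).
* §D LINES / STUBS (no line picked yet: `line = null`, `targets = []`) —
  - solid_step (`stub_curvedToFlat`, `stub_ratBoxes`): `stub_ratBoxes` is rule-(3)-only bookkeeping
    (consistent with §C: boxes have polynomial window values); `stub_curvedToFlat` is summit-implied
    (P = Q), unkillable; by §C its proof at `d = 1` must contain rule (2) in dimension ≥ 2 — the card's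
    "cylindrical decomposition + lower layers" prose does not mention one: the prover should locate it
    (Cavalieri swaps / tilted scissors are rule (2)).
  - relative-injectivity-functional-layer (K1 `FibreNullLayer`, K2 `MeanRealisation`): both
    summit-implied, unkillable. ★★ is this card's lattice made a theorem: K1's fibre-null elements have
    `V ≡ 0` — consistent with FIBRED chains (`KZ.fibredRelations`, the card's "accessibility in
    families"); K2 (realising a transcendental `V_t` as a fibre mean of a relation-trivial `t'`) is
    provably NON-FIBRED: `[t] − [t']` has slice `V_t − 0` transcendental, so it is NOT in
    `fibredRelations ⊔ closure lowDim`. The whole transcendence content of the step sits in ONE non-fibred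
    move (`K₁(d) ⟹ K₀(d+1)`, "integrate the parameter out").
  - fibrewise_stokes (parent, S2): consistent — S2 pads dimensions and S3 permutes coordinates.
  - leray-devissage / kunneth-peel / sym2-bilinear / ax-schanuel: first lemmas summit-implied or
    definitional; nothing cheap to kill; §C applies to each realisation step as above.
* §E OPEN HANDLES (defs below, no sorry) — (E1) permutations: is the step still false for
  `closure ((1),(3), coordinate permutations, dim ≤ 1)`? (Ayoub Rem. 1.5 suggests all directions + one
  extra variable generate one-variable substitutions, so E1 may well be TRUE = a theorem-sized target for
  the positive side; no slice/window-type invariant survives transpositions with the parameter; by ★★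
  the permutations of the FIBRE coordinates are already granted, only those moving coordinate `0`
  matter.) (E2) bounded dimension: does the step `1 → 2` need representations of dimension ≥ 3?
  (E3) `sqRep` in the full calculus: a 12-move chain exists on paper (shear `(s,x) ↦ (s,sx)` [fibred],
  TRANSPOSITION, Newton–Leibniz along `s`, reflection `u ↦ 1−u` in dimension 1) — its only non-fibred
  moves are transpositions; not formalised (non-vacuity is logically guaranteed by §0 anyway).

WHY IT RESISTS. The crux is an implication whose hypothesis (layer 1) is open and whose conclusion is
summit-strength; `¬CKS` is literally `Kc 1 ∧ ¬(kernel conjecture)`. Models where the hypothesis fails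
satisfy it vacuously; models where it holds are as hard to certify as Huber–Wüstholz-in-the-calculus.
The only unconditional content available to an adversary is RELATIVE: which moves / dimensions any
proof must use — §A–§C settle "rule (2), in dimension ≥ 2, already for `d = 1`".
-/

noncomputable section

set_option linter.dupNamespace false

namespace Summit.KontsevichZagierPeriods.KontsevichZagierPeriods.Cruxes.CubeKernelStep.Disproof

open MeasureTheory Set
open Literature.NumberTheory.Transcendental
open Literature.NumberTheory.Transcendental.KZ
open Summit.KontsevichZagierPeriods.KontsevichZagierPeriods.Theses.UnfoldedStokes (CubeKernelStep)
open Summit.KontsevichZagierPeriods.UnfoldedStokes.CubeKernelStepNegative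

/-! ## §0 Calibration (landed: `Negative/Calibration.lean`) -/

/-- The crux is "layer 1 ⇒ all layers". -/
example : CubeKernelStep ↔ (KcIn relations 1 → ∀ M, KcIn relations M) := cubeKernelStep_iff

/-- What a refutation must do. -/
example : ¬ CubeKernelStep ↔ (KcIn relations 1 ∧ ∃ M, ¬ KcIn relations M) := not_cubeKernelStep_iff

/-- A refutation of the crux refutes the summit. -/
example (h : ¬ CubeKernelStep) : ¬ _root_.KontsevichZagierPeriods := not_summit_of_not_cubeKernelStep h

/-! ## §A Load-bearing hypotheses (landed: `Calibration.lean`, `FirstLayerRule2.lean`) -/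

/-- `1 ≤ d` deleted = all layers (full calculus). -/
example : StepFromZeroIn relations ↔ ∀ M, KcIn relations M := stepFromZeroIn_relations_iff

/-- `t.value = 0` is load-bearing modulo layer 1. -/
example (h1 : KcIn relations 1) : ¬ StepWithoutValueIn relations := stepWithoutValue_false_of_kcIn_one h1

/-! ## §B The rule-(2)-free model (landed: `FirstLayerRule2.lean`) -/

/-- Layer 1 fails without rule (2) … -/
example : ¬ KcIn rulesOneThree 1 := firstLayer_false_without_changeOfVariables

/-- … indeed every positive layer does … -/
example (m : ℕ) : ¬ KcIn rulesOneThree (m + 1) := layer_succ_false_without_changeOfVariables m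

/-- … yet the step HOLDS there (vacuously): a model of the crux where the kernel conjecture fails. -/
example : StepIn rulesOneThree := step_without_changeOfVariables

/-- … and the step FROM ZERO fails there: `1 ≤ d` is load-bearing. -/
example : ¬ StepFromZeroIn rulesOneThree := stepFromZero_false_without_changeOfVariables

/-! ## §C ★ The step itself needs rule (2) in dimension ≥ 2 (landed: `SecondWindow.lean`, `StepRule2.lean`) -/

/-- Layers `≤ 1` are granted in the enlarged rule-(2)-free calculus … -/
example {M : ℕ} (hM : M ≤ 1) : KcIn rulesOneThreeLow M := layer_le_one_rulesOneThreeLow hM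

/-- … and still the step fails at `d = 1`: `CubeKernelStep` is FALSE without change of variables. -/
example : ¬ StepIn rulesOneThreeLow := cubeKernelStep_false_without_changeOfVariables

/-- The witness is a genuine kernel element (non-vacuity). -/
example : of sqRep ∈ eval.ker := sqRep_mem_ker_eval

/-- Mechanism: along the enlarged rule-(2)-free calculus the first marginal has a semialgebraic
derivative off a finite set. -/
example {t : IntegralRep 2} (h : of t ∈ rulesOneThreeLow) :
    HasSADeriv (fun e => ∫ z in t.domain ∩ {z : Fin 2 → ℝ | z 0 < e}, t.integrand z) :=
  hasSADeriv_marginal_of_mem h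

/-! ## §C' ★★ The step is not fibred over the parameter (landed: `NotFibred.lean`) -/

/-- Even granting Ayoub's relative rules in all dimensions and everything of dimension `≤ 1`, the
step fails at `d = 1`: any proof moves the parameter coordinate. -/
example : ¬ StepIn (fibredRelations ⊔ AddSubgroup.closure lowDim) := cubeKernelStep_false_fibred

/-- The slice function (period function) of the witness. -/
example {s : ℝ} (hs : s ∈ Icc (0:ℝ) 1) : sliceValue sqRep s = periodFun s := sliceValue_sqRep hs

/-- ★ follows from ★★. -/
example : rulesOneThreeLow ≤ fibredRelations ⊔ AddSubgroup.closure lowDim := rulesOneThreeLow_le_fibred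

/-! ## §C'' ★★★ … even modulo the lower-kernel ideal `I₁` (landed: `IdealSlices.lean`, p147232) -/

/-- The cards' type-(b) relators are relations under the layers (so adding them is fair) … -/
example {d : ℕ} (h : ∀ M : ℕ, M ≤ d → KcIn relations M) :
    lowerKernelGens d ⊆ (relations : Set FormalRep) := lowerKernelGens_subset_relations h

/-- … and still fibred chains do not reach the square layer. -/
example : ¬ StepIn fibredLowIdeal := cubeKernelStep_false_fibred_mod_ideal

/-- Mechanism: a.e. semialgebraic slices along `fibredRelations ⊔ closure lowDim ⊔ closure (lowerKernelGens 1)`. -/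
example {c : FormalRep} (hc : c ∈ fibredLowIdeal) : AESASlice c := aesaSlice_of_mem hc

/-! ## §E Open handles (statements only) -/

/-- Coordinate permutations as moves: `[r] − [r ∘ σ]` for a permutation `σ` of the coordinates (an
instance of rule (2) with a permutation matrix, `|det| = 1`). -/
def permRel : Set FormalRep :=
  {c | ∃ (n : ℕ) (r r' : IntegralRep n) (σ : Equiv.Perm (Fin n)),
    r'.domain = {y | (fun i => y (σ i)) ∈ r.domain} ∧
    (∀ y ∈ r'.domain, r'.integrand y = r.integrand (fun i => y (σ i))) ∧ c = of r - of r'}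

/-- OPEN HANDLE (E1). The step relative to additivity + Newton–Leibniz + coordinate PERMUTATIONS +
everything of dimension `≤ 1`. Expected (Ayoub 2015 Rem. 1.5: all directions and one extra variable
generate one-variable substitutions): possibly TRUE at `d = 1` for a large sector — a positive target,
not a disproof target; no window-type invariant survives permutations. -/
def StepWithPermutations : Prop :=
  StepIn (AddSubgroup.closure (domainAddRel ∪ integrandAddRel ∪ newtonLeibnizRel ∪ lowDim ∪ permRel))

/-- OPEN HANDLE (E2). Bounded dimension: the step `1 → 2` using only representations of dimension `≤ 2`. -/
def FirstStepInDimensionTwo : Prop :=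
  KcIn relations 1 → ∀ t : IntegralRep 2, t.domain = Set.pi Set.univ (fun _ : Fin 2 => Set.Icc (0:ℝ) 1) →
    ContinuousOn t.integrand t.domain → t.value = 0 →
      of t ∈ AddSubgroup.closure {c | c ∈ (domainAddRel ∪ integrandAddRel ∪ changeOfVariablesRel ∪
        newtonLeibnizRel) ∧ ∀ p ∈ c.support, p.1 ≤ 2}

/-- OPEN HANDLE (E3, expected TRUE, paper chain in the module docstring). The witness with fibred
moves, low-dimensional relations and coordinate permutations only. -/
def WitnessByTranspositions : Prop :=
  of sqRep ∈ AddSubgroup.closure (domainAddRel ∪ integrandAddRel ∪ newtonLeibnizRel ∪ lowDim ∪ permRel) ⊔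
    fibredRelations

end Summit.KontsevichZagierPeriods.KontsevichZagierPeriods.Cruxes.CubeKernelStep.Disproof

end
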